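import Mathlib.Algebra.MvPolynomial.Degrees
import Mathlib.Algebra.Field.ZMod
import Literature.Computability.MetaComplexity.SmolenskyProperty
import Literature.Computability.QuantumComplexity.CubicForrelation
import HarnessLib

/-!
# The degree filtration `Smolensky.lowDeg F n D` = functions on `{0,1}ⁿ` represented by a polynomial of
# total degree `≤ D` — the bridge between the tree's two "degree ≤ d" vocabularies

Topic `Literature/Computability/MetaComplexity` (joins `SmolenskyProperty.lean` / `LowDegreeClosure.lean`).
Seat qa-qnc0-lit gen 10 (cell qa-qnc0, route `QuantumAdvantage/RingFrame`): the cell's row codes are stated with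
`Smolensky.lowDeg (ZMod 2) n d` (the SPAN of the multilinear monomials `x_S`, `|S| ≤ d`; the cell's `HasDeg f d` is
"the `0/1` indicator of `f` lies in `lowDeg`"), while the tree's Reed–Muller weight bricks — the Kasami–Tokura second
weight `sw_second_weight_all` and "minimum-weight words are flats" `mw_flat_of_minweight`
(`Summits/QuantumAdvantage/QuantumAdvantage/Theorems/CubicForrelationNearExactIsExact{SecondWeightAll,MinWeightFlat}.lean`)
— are stated with `Literature.Computability.QuantumComplexity.IsDegLeFun d f` ("`f = polyPhase p` for some
`p : MvPolynomial (Fin n) (ZMod 2)` with `p.totalDegree ≤ d`", [Carlet2020 §2.2.1 Def. 6]).  Both say "algebraic degree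
`≤ d`"; this file proves they agree.  (The third vocabulary, the derivative-defined SET `CHHL2018.lowDeg n d` of
`F2PolynomialFourierTailsLevelKProofs.lean`, already has its one-way bridge `QuadPolar.toZFun_mem_lowDeg_of_poly`.)

## Contents (all proved; no named facts)

* `Smolensky.eval_boolPt_mem_lowDeg` — `p.totalDegree ≤ D` ⟹ `(b ↦ eval b̂ p) ∈ lowDeg F n D` (any field), where
  `b̂ = fun i => if b i then 1 else 0` is the `0/1` point of `Fⁿ` attached to `b ∈ {0,1}ⁿ` (written inline throughout,
  exactly as in `Smolensky.mono` and in `IsDegLeFun`; no new definition).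
* `Smolensky.exists_poly_of_mem_lowDeg` — conversely every `P ∈ lowDeg F n D` is `b ↦ eval b̂ p` for some `p` with
  `p.totalDegree ≤ D`; `Smolensky.mem_lowDeg_iff_exists_poly` — the equivalence.
* `Literature.Computability.QuantumComplexity.isDegLeFun_iff_indicator_mem_lowDeg` — over `𝔽₂`:
  `IsDegLeFun d f ↔ (x ↦ if f x then 1 else 0) ∈ Smolensky.lowDeg (ZMod 2) n d`, and the two directions as
  separate lemmas.

Mathematics: standard (a multilinear monomial `x_S` is the evaluation of `Π_{i∈S} Xᵢ`, of total degree `|S|`; a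
monomial `X^s` evaluates on `0/1` points to `x_{supp s}` and `|supp s| ≤ deg s`).  Sources of the STATEMENTS:
[Smolensky1987, p. 78] (functions on the cube over a field `F` = multilinear polynomials, degree) and
[Carlet2020, §2.2.1 Def. 6] (algebraic normal form and algebraic degree over `𝔽₂`).
WHAT THIS IS NOT: no statement about any summit; no new notion of degree.
-/

open Finset MvPolynomial

namespace Literature.Computability.MetaComplexity.Smolensky

variable {F : Type*} [Field F] {n : ℕ}

/-- A positive power of a `0/1` coordinate is the coordinate itself. [folklore] -/
private theorem boolPt_pow {k : ℕ} (hk : k ≠ 0) (b : Fin n → Bool) (i : Fin n) :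
    (if b i then (1 : F) else 0) ^ k = if b i then (1 : F) else 0 := by
  split_ifs
  · exact one_pow k
  · exact zero_pow hk

/-- The product `Π_{i ∈ S} Xᵢ` evaluates at the `0/1` point of `b` to the multilinear monomial `x_S(b)`. [folklore] -/
private theorem eval_boolPt_prod_X (S : Finset (Fin n)) (b : Fin n → Bool) :
    eval (fun i => if b i then (1 : F) else 0) (∏ i ∈ S, (X i : MvPolynomial (Fin n) F)) = mono F S b := by
  rw [map_prod]
  unfold mono
  refine Finset.prod_congr rfl fun i _ => ?_
  rw [eval_X]

/-- A monomial `a·X^s` evaluates at the `0/1` point of `b` to `a · x_{supp s}(b)`. [folklore] -/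
private theorem eval_boolPt_monomial (s : Fin n →₀ ℕ) (a : F) (b : Fin n → Bool) :
    eval (fun i => if b i then (1 : F) else 0) (monomial s a) = a * mono F s.support b := by
  rw [eval_monomial]
  congr 1
  unfold mono Finsupp.prod
  refine Finset.prod_congr rfl fun i hi => ?_
  show (if b i then (1 : F) else 0) ^ s i = _
  rw [boolPt_pow (Finsupp.mem_support_iff.1 hi)]

/-- The support of an exponent vector has at most `deg s = Σᵢ sᵢ` elements. [folklore] -/
private theorem card_support_le_degree (s : Fin n →₀ ℕ) : s.support.card ≤ s.sum fun _ e => e := by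
  unfold Finsupp.sum
  rw [Finset.card_eq_sum_ones]
  exact Finset.sum_le_sum fun i hi => Nat.one_le_iff_ne_zero.2 (Finsupp.mem_support_iff.1 hi)

/-- **Polynomials of total degree `≤ D` define members of `lowDeg F n D`** (restricted to the cube).
[cite: Smolensky1987, p. 78 (Basic notation: every function on the cube is a multilinear polynomial over F; degree = degree of that polynomial)] -/
theorem eval_boolPt_mem_lowDeg {D : ℕ} {p : MvPolynomial (Fin n) F} (hp : p.totalDegree ≤ D) :
    (fun b => eval (fun i => if b i then (1 : F) else 0) p) ∈ lowDeg F n D := by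
  have key : (fun b => eval (fun i => if b i then (1 : F) else 0) p) =
      ∑ s ∈ p.support, coeff s p • mono F s.support := by
    funext b
    conv_lhs => rw [p.as_sum]
    rw [map_sum, Finset.sum_apply]
    refine Finset.sum_congr rfl fun s _ => ?_
    rw [eval_boolPt_monomial, Pi.smul_apply, smul_eq_mul]
  rw [key]
  refine Submodule.sum_mem _ fun s hs => Submodule.smul_mem _ _ (mono_mem_lowDeg ?_)
  exact (card_support_le_degree s).trans ((le_totalDegree hs).trans hp)

/-- **Every member of `lowDeg F n D` is represented by a polynomial of total degree `≤ D`.**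
[cite: Smolensky1987, p. 78 (Basic notation: every function on the cube is a multilinear polynomial over F; degree = degree of that polynomial)] -/
theorem exists_poly_of_mem_lowDeg {D : ℕ} {P : CubeFn F n} (hP : P ∈ lowDeg F n D) :
    ∃ p : MvPolynomial (Fin n) F, p.totalDegree ≤ D ∧ ∀ b, P b = eval (fun i => if b i then (1 : F) else 0) p := by
  rw [lowDeg_eq_span] at hP
  induction hP using Submodule.span_induction with
  | mem x hx =>
    obtain ⟨⟨S, hS⟩, rfl⟩ := hx
    refine ⟨∏ i ∈ S, X i, ?_, fun b => (eval_boolPt_prod_X S b).symm⟩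
    refine (totalDegree_finsetProd _ _).trans ?_
    calc ∑ i ∈ S, (X i : MvPolynomial (Fin n) F).totalDegree = ∑ i ∈ S, 1 :=
          Finset.sum_congr rfl fun i _ => totalDegree_X i
      _ = S.card := (Finset.card_eq_sum_ones S).symm
      _ ≤ D := hS
  | zero => exact ⟨0, by rw [totalDegree_zero]; exact Nat.zero_le _, fun b => by rw [map_zero]; rfl⟩
  | add x y _ _ hx hy =>
    obtain ⟨p, hp, hxp⟩ := hx
    obtain ⟨q, hq, hyq⟩ := hy
    refine ⟨p + q, (totalDegree_add p q).trans (max_le hp hq), fun b => ?_⟩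
    rw [Pi.add_apply, map_add, hxp, hyq]
  | smul a x _ hx =>
    obtain ⟨p, hp, hxp⟩ := hx
    refine ⟨a • p, (totalDegree_smul_le a p).trans hp, fun b => ?_⟩
    rw [Pi.smul_apply, smul_eval, hxp, smul_eq_mul]

/-- `lowDeg F n D` **is** the space of functions on the cube represented by a polynomial of total degree `≤ D`.
[cite: Smolensky1987, p. 78 (Basic notation: every function on the cube is a multilinear polynomial over F; degree = degree of that polynomial)] -/
theorem mem_lowDeg_iff_exists_poly {D : ℕ} {P : CubeFn F n} :
    P ∈ lowDeg F n D ↔ ∃ p : MvPolynomial (Fin n) F, p.totalDegree ≤ D ∧ ∀ b, P b = eval (fun i => if b i then (1 : F) else 0) p := by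
  refine ⟨exists_poly_of_mem_lowDeg, fun ⟨p, hp, hP⟩ => ?_⟩
  have : P = fun b => eval (fun i => if b i then (1 : F) else 0) p := funext hP
  rw [this]
  exact eval_boolPt_mem_lowDeg hp

end Literature.Computability.MetaComplexity.Smolensky

namespace Literature.Computability.QuantumComplexity

open Literature.Computability.MetaComplexity

variable {n : ℕ}

/-- Every element of `𝔽₂` is `0` or `1`. [folklore] -/
private theorem zmod2_eq_zero_or_one (z : ZMod 2) : z = 0 ∨ z = 1 := by
  fin_cases z
  · exact Or.inl rfl
  · exact Or.inr rfl

/-- `IsDegLeFun d f` ⟹ the `0/1` indicator of `f` lies in `Smolensky.lowDeg (ZMod 2) n d`. [cite: Carlet2020, §2.2.1 Def. 6] -/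
theorem indicator_mem_lowDeg_of_isDegLeFun {d : ℕ} {f : (Fin n → Bool) → Bool} (hf : IsDegLeFun d f) :
    (fun x => if f x then (1 : ZMod 2) else 0) ∈ Smolensky.lowDeg (ZMod 2) n d := by
  obtain ⟨p, hp, hfp⟩ := hf
  have key : (fun x => if f x then (1 : ZMod 2) else 0) = fun x => eval (fun i => if x i then (1 : ZMod 2) else 0) p := by
    funext x
    rw [hfp x, polyPhase_apply]
    rcases zmod2_eq_zero_or_one (eval (fun i => if x i then (1 : ZMod 2) else 0) p) with h | h
    · rw [h]; decide
    · rw [h]; decide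
  rw [key]
  exact Smolensky.eval_boolPt_mem_lowDeg hp

/-- The `0/1` indicator of `f` lies in `Smolensky.lowDeg (ZMod 2) n d` ⟹ `IsDegLeFun d f`. [cite: Carlet2020, §2.2.1 Def. 6] -/
theorem isDegLeFun_of_indicator_mem_lowDeg {d : ℕ} {f : (Fin n → Bool) → Bool}
    (hf : (fun x => if f x then (1 : ZMod 2) else 0) ∈ Smolensky.lowDeg (ZMod 2) n d) : IsDegLeFun d f := by
  obtain ⟨p, hp, hfp⟩ := Smolensky.exists_poly_of_mem_lowDeg hf
  refine ⟨p, hp, fun x => ?_⟩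
  rw [polyPhase_apply]
  have hx : (if f x = true then (1 : ZMod 2) else 0) = eval (fun i => if x i then (1 : ZMod 2) else 0) p := hfp x
  cases hfx : f x
  · rw [hfx, if_neg Bool.false_ne_true] at hx
    rw [← hx]; decide
  · rw [hfx, if_pos rfl] at hx
    rw [← hx]; decide

/-- **The two "degree `≤ d`" vocabularies agree**: `IsDegLeFun d f` iff the `0/1` indicator of `f` lies in
`Smolensky.lowDeg (ZMod 2) n d`. [cite: Carlet2020, §2.2.1 Def. 6] -/
theorem isDegLeFun_iff_indicator_mem_lowDeg (d : ℕ) (f : (Fin n → Bool) → Bool) :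
    IsDegLeFun d f ↔ (fun x => if f x then (1 : ZMod 2) else 0) ∈ Smolensky.lowDeg (ZMod 2) n d :=
  ⟨indicator_mem_lowDeg_of_isDegLeFun, isDegLeFun_of_indicator_mem_lowDeg⟩

end Literature.Computability.QuantumComplexity
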